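import Literature.Computability.AlgebraicComplexity.BDI20HwvEvaluationETHProofs
import HarnessLib

/-!
# Bläser–Dörfler–Ikenmeyer 2020/21, §8: the ETH transfer for tableau evaluation problems, packaged
# (any polynomial-time Karp map from `3`-SAT with a linearly bounded parameter yields the ETH clause)

Theorem-only toolkit file of the cell `val-lit` (seat x6), abstracting §4–§5 of
`BDI20HwvEvaluationETHProofs.lean` (the discharge of `BDI2020_thm_8_1_eth`) over the target problem,
so that the remaining ETH clause of the source — `BDI2020_thm_8_9_eth` (Thm 8.9 = arXiv Thm 30,
semistandard tableaux, parameter `√n`) — and any further statement of the shape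
`ETH → ¬ BDI2020.HasSubexpDecider S g` reduce to the construction of ONE Karp map. No new named fact,
no `instance`, no `notation`, no `def`. HONEST FRAMING: fine-grained bookkeeping (Impagliazzo–Paturi–
Zane SERF reductions, Ladner–Lynch–Selman one-query packaging); ETH is a hypothesis; nothing here
bears on `VP ≠ VNP`, which is NOT proved.

* `BDI20ETH.serfReducible_kSAT_of_codeFP`: if `red : {0,1}* → tableaux` is computed on all strings by
  a polynomial-time function (`CodeFP strE tabE red`), is a many-one reduction `x ∈ 3SAT ⟺ red x ∈ S`,
  and the parameter of its image is linear in the number of clauses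
  (`g (numLabels (red x)) - 1 ≤ C · (kSATClauseParam 3).param x`), then `3`-SAT with parameter `m`
  SERF-reduces to `BDI2020.subexpParam S g`.
* `BDI20ETH.not_hasSubexpDecider_of_codeFP`: under ETH, such a map (and one tableau `T₀ ∉ S`) rules
  out a `2^{o(g(n))}` decider for `S` (`eth_iff_kSATClauseParam_not_mem_SE_holds`,
  `BDI2020.subexpParam_mem_SE`, `mem_SE_of_serfReducible_holds`).
* The landed discharge `BDI2020_thm_8_1_eth_holds` is the instance `S = nonvanishingSet₃ d m`, `g = id`,
  `red = BDI20ETH.reduce d`, `C = 40`, `T₀ = BDI20ETH.junkTab` (with `BDI20ETH.reduceFP`,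
  `BDI20ETH.mem_kSAT_iff_reduce_mem`, `BDI20ETH.param_reduce_le`); it is not restated here.

## References
* [BlaserDorflerIkenmeyer2020] arXiv:2002.11594, Thms 22, 30 (ETH clauses) = CCC 2021 Thms 8.1, 8.9.
* [ImpagliazzoPaturiZaneJCSS2001] JCSS 63 (2001), §2.1 (SERF reductions; SE closed under them), Cor. 2.
* [LadnerLynchSelman1975] TCS 1 (1975), p. 104 and Prop. 2.1.
* [AroraBarak2009] CUP 2009, §1.3, Def. 2.7.
-/

noncomputable section

open _root_.Computability

namespace Literature.Computability.AlgebraicComplexity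

namespace BDI20ETH

open Literature.Computability.Complexity Literature.Computability.Cryptography
open Literature.Computability.FineGrained (kSATClauseParam kSATClauseParam_lang kSATClauseParam_param_encode
  exists_eval_le_mul_succ_pow mul_succ_pow_mono eth_iff_kSATClauseParam_not_mem_SE_holds ETH)
open CodeFP Brick BDI2020 BDI20NPHard

/-- **A polynomial-time Karp map from `3`-SAT to a tableau problem `S` whose image has parameter
`O(m)` is a SERF reduction from `3`-SAT with parameter `m` to `subexpParam S g`** (one query, answered
by the oracle bit; Ladner–Lynch–Selman packaging `karpAlg`/`karpLift`; the family does not depend on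
`ε`). [cite: ImpagliazzoPaturiZaneJCSS2001, §2.1 (SERF reductions)] [cite: LadnerLynchSelman1975, p. 104 and Prop. 2.1] -/
theorem serfReducible_kSAT_of_codeFP {S : Set (List (List ℕ))} {g : ℕ → ℕ} {red : List Bool → List (List ℕ)}
    {C : ℕ} (hred : CodeFP strE tabE red) (hmem : ∀ x, x ∈ kSAT 3 ↔ red x ∈ S)
    (hpar : ∀ x, g (numLabels (red x)) - 1 ≤ C * (kSATClauseParam 3).param x) :
    SERFReducible (kSATClauseParam 3) (subexpParam S g) := by
  intro ε hε
  obtain ⟨f, hf, hfeq⟩ := hred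
  have hfx : ∀ x, f x = tableauEncoding.encode (red x) := fun x => by rw [tabE_eq]; exact hfeq x
  obtain ⟨p, Mr, hMr⟩ := hf
  obtain ⟨s, hs⟩ := exists_poly_length_le_of_mem_FP (show f ∈ FP from ⟨p, Mr, hMr⟩)
  obtain ⟨C₁, hC₁, hp⟩ := exists_eval_le_mul_succ_pow p
  obtain ⟨C₂, hC₂, hsC⟩ := exists_eval_le_mul_succ_pow s
  let Tstep : List Bool × List (List Bool) → ℕ := fun q =>
    p.eval q.1.length + (2 * q.1.length + 4) + (boolPair q.1 ((encodingList Bool).listBool.encode q.2)).length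
  have hT : ∀ (x : List Bool) (as : List (List Bool)),
      Tstep (x, as) ≤ (C₁ + 6) * (x.length + 1) ^ (C₁ + 6) * (((encodingList Bool).listBool.encode as).length + 1) := by
    intro x as
    have h1 : p.eval x.length + 4 * x.length + 6 ≤ (C₁ + 6) * (x.length + 1) ^ (C₁ + 6) := by
      have e1 := hp x.length
      have e2 : (x.length + 1) ≤ (x.length + 1) ^ C₁ := by
        simpa using Nat.pow_le_pow_right (Nat.succ_pos x.length) hC₁
      have e3 := mul_succ_pow_mono (show C₁ ≤ C₁ + 6 by omega) x.length
      have e4 : (x.length + 1) ^ C₁ ≤ (x.length + 1) ^ (C₁ + 6) := Nat.pow_le_pow_right (Nat.succ_pos _) (by omega)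
      nlinarith
    have h2 : 1 ≤ (C₁ + 6) * (x.length + 1) ^ (C₁ + 6) := Nat.one_le_iff_ne_zero.2 (by positivity)
    have h3 : Tstep (x, as) = p.eval x.length + 4 * x.length + 6 + ((encodingList Bool).listBool.encode as).length := by
      simp only [Tstep, length_boolPair]; omega
    rw [h3]
    nlinarith
  refine ⟨karpAlg f, fun _ => 2, Tstep, max C (2 * C₂), ⟨2, fun x => ?_⟩, ⟨karpLift Mr, ?_⟩, ⟨C₁ + 6, fun x as => ?_⟩,
    fun x => ?_, fun x q hq => ?_⟩
  · -- the round budget `2` is subexponential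
    have h2 : (1 : ℝ) ≤ (2 : ℝ) ^ (ε * ((kSATClauseParam 3).param x : ℝ)) := Real.one_le_rpow one_le_two (by positivity)
    have h3 : (1 : ℝ) ≤ ((x.length : ℝ) + 1) ^ (2 : ℕ) := one_le_pow₀ (by linarith [Nat.cast_nonneg (α := ℝ) x.length])
    calc (((fun _ : List Bool => (2 : ℕ)) x : ℕ) : ℝ) = 2 * 1 * 1 := by norm_num
      _ ≤ (2 : ℕ) * (2 : ℝ) ^ (ε * ((kSATClauseParam 3).param x : ℝ)) * ((x.length : ℝ) + 1) ^ (2 : ℕ) := by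
        push_cast; gcongr
  · -- the step machine
    rintro ⟨x, _ | ⟨a, as⟩⟩
    · change (karpLift Mr).OutputsWithin (boolPair x ((encodingList Bool).listBool.encode [])) (false :: f x) (Tstep (x, []))
      rw [listBool_encode_nil]
      refine (outputsWithin_karpLift_query Mr (hMr x)).mono ?_
      simp only [Tstep, id, listBool_encode_nil]
      omega
    · change (karpLift Mr).OutputsWithin (boolPair x ((encodingList Bool).listBool.encode (a :: as)))
        [true, a.headD false] (Tstep (x, a :: as))
      refine (outputsWithin_karpLift_answer Mr x a as).mono ?_
      simp only [Tstep]
      omega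
  · -- the step time is within the SERF bound
    have h1 : (Tstep (x, as) : ℝ) ≤ ((C₁ + 6 : ℕ) : ℝ) * ((x.length : ℝ) + 1) ^ (C₁ + 6) *
        ((((encodingList Bool).listBool.encode as).length : ℝ) + 1) := by exact_mod_cast hT x as
    refine h1.trans ?_
    have h2 : (1 : ℝ) ≤ (2 : ℝ) ^ (ε * ((kSATClauseParam 3).param x : ℝ)) := Real.one_le_rpow one_le_two (by positivity)
    calc ((C₁ + 6 : ℕ) : ℝ) * ((x.length : ℝ) + 1) ^ (C₁ + 6) * ((((encodingList Bool).listBool.encode as).length : ℝ) + 1)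
        = ((C₁ + 6 : ℕ) : ℝ) * 1 * ((x.length : ℝ) + 1) ^ (C₁ + 6) *
          ((((encodingList Bool).listBool.encode as).length : ℝ) + 1) := by ring
      _ ≤ ((C₁ + 6 : ℕ) : ℝ) * (2 : ℝ) ^ (ε * ((kSATClauseParam 3).param x : ℝ)) * ((x.length : ℝ) + 1) ^ (C₁ + 6) *
          ((((encodingList Bool).listBool.encode as).length : ℝ) + 1) := by gcongr
  · -- the run: one query, the oracle's answer bit is the answer
    have hrun : (karpAlg f).run (Oracle.ofLanguage (subexpParam S g).lang) 2 x =
        some (((Oracle.ofLanguage (subexpParam S g).lang) (f x)).headD false) := run_karpAlg f _ 0 x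
    rw [hrun, Oracle.ofLanguage_apply, subexpParam_lang, kSATClauseParam_lang]
    simp only [encodeBool, Option.some.injEq]
    have hiff : x ∈ kSAT 3 ↔ f x ∈ tableauEncoding.toLanguage S := by
      rw [hfx, Encoding.mem_toLanguage_iff]; exact hmem x
    rcases Bool.eq_false_or_eq_true ((kSAT 3).boolIndicator x) with h1 | h1
    · rw [h1]
      exact (Set.mem_iff_boolIndicator _ _).1 (hiff.1 ((Set.mem_iff_boolIndicator _ _).2 h1))
    · rw [h1]
      exact (Set.notMem_iff_boolIndicator _ _).1 fun h => (Set.notMem_iff_boolIndicator _ _).2 h1 (hiff.2 h)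
  · -- the query: parameter `≤ C m`, length polynomial
    have hq' : q = f x := by
      have hqs : (karpAlg f).queries (Oracle.ofLanguage (subexpParam S g).lang) 2 x = [f x] := queries_karpAlg f _ 0 x
      rw [hqs, List.mem_singleton] at hq
      exact hq
    subst hq'
    refine ⟨?_, ?_⟩
    · rw [hfx, subexpParam_param_encode]
      exact (hpar x).trans (Nat.mul_le_mul_right _ (le_max_left _ _))
    · refine (hs x).trans ((hsC x.length).trans ?_)
      refine le_trans ?_ (mul_succ_pow_mono (le_max_right C (2 * C₂)) x.length)
      exact (Nat.mul_le_mul_left _ (Nat.pow_le_pow_right (Nat.succ_pos _) (by omega))).trans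
        (Nat.mul_le_mul_right _ (by omega))

/-- **The ETH transfer for tableau problems.** Under ETH, a polynomial-time Karp map from `3`-SAT to
the tableau problem `S` whose image has parameter `g(numLabels) - 1 ≤ C · m` rules out every
`2^{o(g(n))}`-time decider for `S` (in the sense of `BDI2020.HasSubexpDecider`): `3`-SAT with parameter
`m` is not in `SE` under ETH (Impagliazzo–Paturi–Zane Cor. 2 over the proved sparsification lemma),
while such a decider would put `subexpParam S g` in `SE` and `SE` is closed under SERF reductions.
[cite: ImpagliazzoPaturiZaneJCSS2001, §2.1 and Cor. 2] [cite: BlaserDorflerIkenmeyer2020, Thms 22, 30 (arXiv; = CCC 2021 Thms 8.1, 8.9: "assuming ETH")] -/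
theorem not_hasSubexpDecider_of_codeFP (hETH : ETH) {S : Set (List (List ℕ))} {g : ℕ → ℕ}
    {red : List Bool → List (List ℕ)} {C : ℕ} {T₀ : List (List ℕ)} (hT₀ : T₀ ∉ S)
    (hred : CodeFP strE tabE red) (hmem : ∀ x, x ∈ kSAT 3 ↔ red x ∈ S)
    (hpar : ∀ x, g (numLabels (red x)) - 1 ≤ C * (kSATClauseParam 3).param x) :
    ¬ HasSubexpDecider S g := fun hdec =>
  (eth_iff_kSATClauseParam_not_mem_SE_holds.1 hETH)
    (mem_SE_of_serfReducible_holds (serfReducible_kSAT_of_codeFP hred hmem hpar) (subexpParam_mem_SE hT₀ hdec))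

end BDI20ETH

end Literature.Computability.AlgebraicComplexity

end
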